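import Summits.BirchSwinnertonDyer.BirchSwinnertonDyer.Theorems.ManinLocalTwoThreeManinPrimeToAdditiveFiveLeOfPrintAndItems
import Summits.BirchSwinnertonDyer.BirchSwinnertonDyer.Theorems.EdixhovenFibreFiveSevenStarredOptimalManinUnitFiveSevenTameTwistLever
import HarnessLib

/-!
# Route `ManinLocalTwoThree`, residual crux C5 `ManinPrimeToAdditiveFiveLe`
# (stmt-BirchSwinnertonDyer-22969), line `upper_anchor`: **the Kato reduction and the line ledger
# with ONE Kato fact — F″ alone (F′ is its `p > 7` specialisation)**

Allocation ζ of the lead bsd-line-ml23-c5-p1 (gen 2, HOME INBOX 2026-08-28T06:52:11Z). The two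
statement-only Kato–Kim–Nakamura readings of
`Literature/NumberTheory/EllipticCurves/KatoAdditiveTwistedValueNeronIntegrality.lean` differ EXACTLY by
the binder `7 < p` (F′ = `kato_neron_isIntegral_twistedSymbolSum_of_additive`) versus
`5 ≤ p ∧ (7 < p ∨ W(ℚ_p)[p] = 0)` (F″ = `kato_neron_isIntegral_twistedSymbolSum_of_additive_five_le`),
so F″ ⟹ F′ by taking the left disjunct — already a tree theorem of cell `pub/bsd-wall`
(`Cruxes.StarredOptimalManinUnitFiveSeven.KatoLever.kato_neron_of_five_le`, file
`Theorems/EdixhovenFibreFiveSevenStarredOptimalManinUnitFiveSevenTameTwistLever.lean`), which this file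
REUSES (ζ1; no restatement). Feeding it into the lead's Kato reduction (p608285, p609325) and the width
seat's line ledger (p610200) removes the F′ binder everywhere:

* §1 `maninLocalTwoThree_not_dvd_maninConstant_of_kato57_of_irreducible` (ζ2) — Manin's `p`-part at an
  additive `p ≥ 5` with `E[p]` irreducible, off the Kosters–Pannekoek exception at `p ∈ {5,7}`,
  GRANTED F″ only (= p608285 §1 with the F′ binder dropped);
* §2 `maninLocalTwoThree_maninPrimeToAdditiveFiveLe_of_kato57_of_cores` and
  `maninLocalTwoThree_maninPrimeToAdditiveFiveLe_of_kato57_of_kp57_of_reducible` — C5 BY NAME ⟸ F″ ∧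
  core(KP) ∧ stub 2, resp. ⟸ F″ ∧ ČNS ∧ Cremona(≤ 5·10⁵) ∧ KP57 (stmt-BirchSwinnertonDyer-23810, BY
  NAME) ∧ stub 2 (= p608285 §2 / p609325 §2 with the F′ binder dropped; stub 2 = the registered
  `stub_reducibleTwistMinimal` of line `upper_anchor`, VERBATIM as a hypothesis);
* §3 `maninPrimeToAdditiveFiveLe_of_kato57_print_of_kp57_of_reducibleCores` (ζ3) — THE LINE LEDGER WITH
  THE MINIMAL FACT LIST: **C5 BY NAME ⟸ five PRINTED facts {F″, ČNS Thm. 1.2, Cremona ≤ 5·10⁵,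
  Edixhoven 1991 Thm. 3 (Kodaira half), Edixhoven 1991 Thm. 3 (ordinarity half)} ∧ ONE registered open
  crux {KP57} ∧ TWO explicit open cores {RED(57), RED(11)}** (= p610200 with F′ discharged by ζ1).

HONEST STATUS: conditional-result (`--supports … --as helper`); closes nothing. Every hypothesis is a
named statement-only tree fact (cite-only: F″ is a DERIVED READING of Kato 2004 + Kim–Nakamura 2020 +
Kosters–Pannekoek 2017, flagged for referee audit in its own docstring; ČNS 2024 Thm. 1.2; Cremona's
table; Edixhoven 1991 Thm. 3 twice), a registered open item (KP57), or an explicit open core (RED(57):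
`p ∈ {5,7}`, `E[p]` reducible; RED(11): `p > 7`, `E[p]` reducible, `ord_p Δ_min ≤ 4`, potentially good
ordinary in the (G)-shape, `p ∣ deg φ`). Nothing here proves BSD, Manin's conjecture or C5.
Seat bsd-line-ml23-c5-p1-w2 (width prover, gen 2).

References: [Kato2004Asterisque] (8.1.3) (p. 180), Thm. 9.7 (p. 189), Thm. 6.6 (1); [KimNakamura2020]
Thm. 2.1, Cor. 2.4; [KostersPannekoek2017] Thm. 1, Cor. 2; [EdixhovenManin1991] Thm. 3;
[CesnaviciusNeururerSaha2023] Thm. 1.2; [Cremona2022ManinConstants]; [KrausOesterle1992].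
-/

set_option autoImplicit false
-- the Theorems namespace of this sub repeats the summit name by design (D-0017 nested layout)
set_option linter.dupNamespace false

noncomputable section

open scoped Classical NumberField

namespace Summit.BirchSwinnertonDyer.BirchSwinnertonDyer.Theorems

open WeierstrassCurve IsDedekindDomain NumberField
  Literature.NumberTheory.EllipticCurves Literature.NumberTheory.EllipticCurves.ModularForms
  Literature.NumberTheory.EllipticCurves.Rank1Residual
  Summit.BirchSwinnertonDyer.Rank1Residual.ManinAdditive
  Summit.BirchSwinnertonDyer.BirchSwinnertonDyer.Theses.EdixhovenFibreFiveSeven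
  Summit.BirchSwinnertonDyer.BirchSwinnertonDyer.Cruxes.StarredOptimalManinUnitFiveSeven.KatoLever

/-! ## §1 The irreducible locus, granted F″ alone (ζ2) -/

/-- **Manin's `p`-part at an additive `p ≥ 5` with `E[p]` irreducible, GRANTED F″ only — off the
Kosters–Pannekoek exception at `p ∈ {5,7}`.** For `W/ℚ` globally minimal with a lattice-optimal datum
`D` (`Λ_W ⊆ c·Λ_f`) at a level `N` with `p² ∣ N`, `E[p]` irreducible, and — only when `p ∈ {5,7}` — no
point of order `p` in `W(ℚ_p)`: `p ∤ c(D)`. Proof: the lead's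
`maninLocalTwoThree_not_dvd_maninConstant_of_kato_of_irreducible` (p608285 §1) with its F′ binder fed by
`kato_neron_of_five_le hK57` (F″ ⟹ F′, left disjunct). CONDITIONAL on F″ (a derived reading, cite-only).
[cite: Kato2004Asterisque, (8.1.3) (p. 180), Thm. 9.7 (p. 189), Thm. 6.6 (1) (p. 163)]
[cite: KimNakamura2020, Thm. 2.1, Cor. 2.4] [cite: KostersPannekoek2017, Thm. 1 and Cor. 2] -/
theorem maninLocalTwoThree_not_dvd_maninConstant_of_kato57_of_irreducible
    (hK57 : kato_neron_isIntegral_twistedSymbolSum_of_additive_five_le)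
    (hnf : exists_isNewformOf)
    (W : WeierstrassCurve ℚ) [W.IsElliptic] [W.IsGloballyMinimal] {N : ℕ} [NeZero N]
    (D : ModularParametrizationData W N)
    (hopt : ∀ z ∈ D.L.lattice, ∃ w ∈ periodLattice D.f, z = D.c * w)
    {p : ℕ} [Fact p.Prime] (h5 : 5 ≤ p) (hpN : p ^ 2 ∣ N) (hirr : W.HasIrreducibleModPGaloisRep p)
    (hPT : p = 5 ∨ p = 7 → ∀ P : (W.baseChange ℚ_[p]).toAffine.Point, p • P = 0 → P = 0) :
    ¬ (p : ℤ) ∣ D.maninConstant :=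
  maninLocalTwoThree_not_dvd_maninConstant_of_kato_of_irreducible (kato_neron_of_five_le hK57) hK57 hnf
    W D hopt h5 hpN hirr hPT

/-! ## §2 C5 BY NAME granted F″: the Kosters–Pannekoek corner and the reducible residue remain -/

/-- **KATO REDUCTION of C5 with ONE Kato fact (conditional).** Granted F″ alone, crux C5
`ManinLocalTwoThree.ManinPrimeToAdditiveFiveLe` follows from its restriction to (KP) `p ∈ {5,7}`, `E[p]`
irreducible, `W(ℚ_p)` has a point of order `p`, and (RED) `E[p]` reducible — the latter VERBATIM the
registered stub `stub_reducibleTwistMinimal` of line `upper_anchor` —, both on globally twist-minimal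
classes with conductor-level lattice-optimal data (= p608285 §2 with the F′ binder dropped). C5 itself
is NOT proved; (KP) is the territory of crux KP57 (stmt-BirchSwinnertonDyer-23810).
[cite: Kato2004Asterisque, (8.1.3) (p. 180), Thm. 9.7 (p. 189)] [cite: KimNakamura2020, Cor. 2.4]
[cite: KostersPannekoek2017, Thm. 1 and Cor. 2] -/
theorem maninLocalTwoThree_maninPrimeToAdditiveFiveLe_of_kato57_of_cores
    (hK57 : kato_neron_isIntegral_twistedSymbolSum_of_additive_five_le)
    (hKP : ∀ (W : WeierstrassCurve ℚ) [W.IsElliptic] [W.IsGloballyMinimal]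
      [NeZero (W.conductorNorm ℤ)] (D : ModularParametrizationData W (W.conductorNorm ℤ)),
      IsLatticeOptimal D → ∀ (p : ℕ) [Fact p.Prime], (p = 5 ∨ p = 7) → p ^ 2 ∣ W.conductorNorm ℤ →
      ¬ (∃ (W' : WeierstrassCurve ℚ) (q : ℕ), W'.IsElliptic ∧ W'.IsGloballyMinimal ∧
          q.Prime ∧ q ≠ 2 ∧ q ^ 2 ∣ W.conductorNorm ℤ ∧
          IsIsogenous W (W'.quadraticTwist (((-1 : ℤ) ^ (q / 2) * q : ℤ) : ℚ)) ∧
          ¬ q ^ 2 ∣ W'.conductorNorm ℤ) →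
      ¬ (∃ (W' : WeierstrassCurve ℚ) (d : ℤ), W'.IsElliptic ∧ W'.IsGloballyMinimal ∧
          (d = -1 ∨ d = 2 ∨ d = -2) ∧ 2 ^ 2 ∣ W.conductorNorm ℤ ∧
          IsIsogenous W (W'.quadraticTwist (d : ℚ)) ∧ ¬ 2 ^ 2 ∣ W'.conductorNorm ℤ) →
      W.HasIrreducibleModPGaloisRep p →
      (∃ P : (W.baseChange ℚ_[p]).toAffine.Point, p • P = 0 ∧ P ≠ 0) →
      ¬ (p : ℤ) ∣ D.maninConstant)
    (hRED : mazur_not_dvd_maninConstant_of_odd → abbesUllmo_not_dvd_maninConstant_of_not_dvd_level →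
      cesnavicius_not_two_dvd_maninConstant_of_two_dvd_level → exists_isNewformOf →
      ∀ (W : WeierstrassCurve ℚ) [W.IsElliptic] [W.IsGloballyMinimal] [NeZero (W.conductorNorm ℤ)]
        (D : ModularParametrizationData W (W.conductorNorm ℤ)),
        IsLatticeOptimal D → ∀ p : ℕ, p.Prime → 5 ≤ p → p ^ 2 ∣ W.conductorNorm ℤ →
        ¬ (∃ (W' : WeierstrassCurve ℚ) (q : ℕ), W'.IsElliptic ∧ W'.IsGloballyMinimal ∧ q.Prime ∧
            q ≠ 2 ∧ q ^ 2 ∣ W.conductorNorm ℤ ∧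
            IsIsogenous W (W'.quadraticTwist (((-1 : ℤ) ^ (q / 2) * q : ℤ) : ℚ)) ∧
            ¬ q ^ 2 ∣ W'.conductorNorm ℤ) →
        ¬ (∃ (W' : WeierstrassCurve ℚ) (d : ℤ), W'.IsElliptic ∧ W'.IsGloballyMinimal ∧
            (d = -1 ∨ d = 2 ∨ d = -2) ∧ 2 ^ 2 ∣ W.conductorNorm ℤ ∧
            IsIsogenous W (W'.quadraticTwist (d : ℚ)) ∧ ¬ 2 ^ 2 ∣ W'.conductorNorm ℤ) →
        ¬ W.HasIrreducibleModPGaloisRep p →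
        ¬ (p : ℤ) ∣ D.maninConstant) :
    Summit.BirchSwinnertonDyer.BirchSwinnertonDyer.Theses.ManinLocalTwoThree.ManinPrimeToAdditiveFiveLe :=
  maninLocalTwoThree_maninPrimeToAdditiveFiveLe_of_kato_of_cores (kato_neron_of_five_le hK57) hK57 hKP
    hRED

/-- **C5 `ManinLocalTwoThree.ManinPrimeToAdditiveFiveLe` ⟸ {F″, ČNS, Cremona ≤ 5·10⁵} (cite-only
facts) ∧ KP57 (stmt-BirchSwinnertonDyer-23810, open crux, BY NAME) ∧ stub 2 (`stub_reducibleTwistMinimal`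
of line `upper_anchor`, VERBATIM)** — the lead's p609325 §2 with the F′ binder dropped (F′ :=
`kato_neron_of_five_le hK57`). CONDITIONAL: C5 is NOT proved; every hypothesis is a named tree fact or a
registered open item. [cite: Kato2004Asterisque, (8.1.3) (p. 180), Thm. 9.7 (p. 189)]
[cite: KimNakamura2020, Cor. 2.4] [cite: KostersPannekoek2017, Thm. 1 and Cor. 2]
[cite: CesnaviciusNeururerSaha2023, Thm. 1.2] -/
theorem maninLocalTwoThree_maninPrimeToAdditiveFiveLe_of_kato57_of_kp57_of_reducible
    (hK57 : kato_neron_isIntegral_twistedSymbolSum_of_additive_five_le)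
    (hCNS : cesnaviciusNeururerSaha_padicVal_maninConstant_le_modularDegree)
    (h500k : cremona_abs_maninConstant_eq_one_of_level_le_500000)
    (hKP57 : KPResidueManinUnitFiveSeven)
    (hRED : mazur_not_dvd_maninConstant_of_odd → abbesUllmo_not_dvd_maninConstant_of_not_dvd_level →
      cesnavicius_not_two_dvd_maninConstant_of_two_dvd_level → exists_isNewformOf →
      ∀ (W : WeierstrassCurve ℚ) [W.IsElliptic] [W.IsGloballyMinimal] [NeZero (W.conductorNorm ℤ)]
        (D : ModularParametrizationData W (W.conductorNorm ℤ)),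
        IsLatticeOptimal D → ∀ p : ℕ, p.Prime → 5 ≤ p → p ^ 2 ∣ W.conductorNorm ℤ →
        ¬ (∃ (W' : WeierstrassCurve ℚ) (q : ℕ), W'.IsElliptic ∧ W'.IsGloballyMinimal ∧ q.Prime ∧
            q ≠ 2 ∧ q ^ 2 ∣ W.conductorNorm ℤ ∧
            IsIsogenous W (W'.quadraticTwist (((-1 : ℤ) ^ (q / 2) * q : ℤ) : ℚ)) ∧
            ¬ q ^ 2 ∣ W'.conductorNorm ℤ) →
        ¬ (∃ (W' : WeierstrassCurve ℚ) (d : ℤ), W'.IsElliptic ∧ W'.IsGloballyMinimal ∧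
            (d = -1 ∨ d = 2 ∨ d = -2) ∧ 2 ^ 2 ∣ W.conductorNorm ℤ ∧
            IsIsogenous W (W'.quadraticTwist (d : ℚ)) ∧ ¬ 2 ^ 2 ∣ W'.conductorNorm ℤ) →
        ¬ W.HasIrreducibleModPGaloisRep p →
        ¬ (p : ℤ) ∣ D.maninConstant) :
    Summit.BirchSwinnertonDyer.BirchSwinnertonDyer.Theses.ManinLocalTwoThree.ManinPrimeToAdditiveFiveLe :=
  maninLocalTwoThree_maninPrimeToAdditiveFiveLe_of_kato_of_kp57_of_reducible (kato_neron_of_five_le hK57)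
    hK57 hCNS h500k hKP57 hRED

/-! ## §3 The line ledger with the minimal fact list (ζ3) -/

/-- **C5 `ManinPrimeToAdditiveFiveLe` BY NAME ⟸ five printed facts + KP57 + two open cores** (line
`upper_anchor`'s ledger with ONE Kato fact; conditional-result, C5 is NOT proved): Kato F″ (`hK57`),
ČNS Thm. 1.2 (`hCNS`), Cremona ≤ 5·10⁵ (`h500k`), Edixhoven Thm. 3 Kodaira half (`hEdK`) and
ordinarity half (`hEdG`); the registered crux KP57 BY NAME (`hKP57`); cores RED(57) (`h57`: `p ∈ {5,7}`,
`E[p]` reducible) and RED(11) (`h11`: `p > 7`, `E[p]` reducible, `ord_p Δ_min ≤ 4`, (G)-ordinary,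
`p ∣ deg φ`), both on globally twist-minimal classes with conductor-level lattice-optimal data. Proof:
the width seat's p610200 with F′ := `kato_neron_of_five_le hK57`.
[cite: Kato2004Asterisque, (8.1.3) (p. 180), Thm. 9.7 (p. 189)] [cite: KimNakamura2020, Cor. 2.4]
[cite: KostersPannekoek2017, Thm. 1 and Cor. 2] [cite: EdixhovenManin1991, Thm. 3]
[cite: CesnaviciusNeururerSaha2023, Thm. 1.2] -/
theorem maninPrimeToAdditiveFiveLe_of_kato57_print_of_kp57_of_reducibleCores
    (hK57 : kato_neron_isIntegral_twistedSymbolSum_of_additive_five_le)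
    (hCNS : cesnaviciusNeururerSaha_padicVal_maninConstant_le_modularDegree)
    (h500k : cremona_abs_maninConstant_eq_one_of_level_le_500000)
    (hEdK : edixhoven_not_dvd_maninConstant_of_kodairaSymbol_ne)
    (hEdG : edixhoven_not_dvd_maninConstant_of_not_potentiallyGoodOrdinary)
    (hKP57 : KPResidueManinUnitFiveSeven)
    (h57 : mazur_not_dvd_maninConstant_of_odd → abbesUllmo_not_dvd_maninConstant_of_not_dvd_level →
      cesnavicius_not_two_dvd_maninConstant_of_two_dvd_level → exists_isNewformOf →
      ∀ (W : WeierstrassCurve ℚ) [W.IsElliptic] [W.IsGloballyMinimal] [NeZero (W.conductorNorm ℤ)]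
        (D : ModularParametrizationData W (W.conductorNorm ℤ)),
        IsLatticeOptimal D → ∀ p : ℕ, p.Prime → (p = 5 ∨ p = 7) → p ^ 2 ∣ W.conductorNorm ℤ →
        ¬ (∃ (W' : WeierstrassCurve ℚ) (q : ℕ), W'.IsElliptic ∧ W'.IsGloballyMinimal ∧ q.Prime ∧
            q ≠ 2 ∧ q ^ 2 ∣ W.conductorNorm ℤ ∧
            IsIsogenous W (W'.quadraticTwist (((-1 : ℤ) ^ (q / 2) * q : ℤ) : ℚ)) ∧
            ¬ q ^ 2 ∣ W'.conductorNorm ℤ) →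
        ¬ (∃ (W' : WeierstrassCurve ℚ) (d : ℤ), W'.IsElliptic ∧ W'.IsGloballyMinimal ∧
            (d = -1 ∨ d = 2 ∨ d = -2) ∧ 2 ^ 2 ∣ W.conductorNorm ℤ ∧
            IsIsogenous W (W'.quadraticTwist (d : ℚ)) ∧ ¬ 2 ^ 2 ∣ W'.conductorNorm ℤ) →
        ¬ W.HasIrreducibleModPGaloisRep p →
        ¬ (p : ℤ) ∣ D.maninConstant)
    (h11 : mazur_not_dvd_maninConstant_of_odd → abbesUllmo_not_dvd_maninConstant_of_not_dvd_level →
      cesnavicius_not_two_dvd_maninConstant_of_two_dvd_level → exists_isNewformOf →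
      ∀ (W : WeierstrassCurve ℚ) [W.IsElliptic] [W.IsGloballyMinimal] [NeZero (W.conductorNorm ℤ)]
        (D : ModularParametrizationData W (W.conductorNorm ℤ)),
        IsLatticeOptimal D → ∀ p : ℕ, p.Prime → 7 < p → p ^ 2 ∣ W.conductorNorm ℤ →
        ¬ (∃ (W' : WeierstrassCurve ℚ) (q : ℕ), W'.IsElliptic ∧ W'.IsGloballyMinimal ∧ q.Prime ∧
            q ≠ 2 ∧ q ^ 2 ∣ W.conductorNorm ℤ ∧
            IsIsogenous W (W'.quadraticTwist (((-1 : ℤ) ^ (q / 2) * q : ℤ) : ℚ)) ∧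
            ¬ q ^ 2 ∣ W'.conductorNorm ℤ) →
        ¬ (∃ (W' : WeierstrassCurve ℚ) (d : ℤ), W'.IsElliptic ∧ W'.IsGloballyMinimal ∧
            (d = -1 ∨ d = 2 ∨ d = -2) ∧ 2 ^ 2 ∣ W.conductorNorm ℤ ∧
            IsIsogenous W (W'.quadraticTwist (d : ℚ)) ∧ ¬ 2 ^ 2 ∣ W'.conductorNorm ℤ) →
        ¬ W.HasIrreducibleModPGaloisRep p →
        padicValInt p W.minimalDiscriminantInt ≤ 4 →
        (∃ (L : Type) (_ : Field L) (_ : NumberField L) (_ : IsCyclotomicExtension {p} ℚ L)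
            (F : IntermediateField ℚ L),
            ∀ w : HeightOneSpectrum (𝓞 F), (p : 𝓞 F) ∈ w.asIdeal →
              (W.baseChange F).HasGoodReductionAt w ∧ (W.baseChange F).HasUnitRootAt w) →
        p ∣ D.modularDegree →
        ¬ (p : ℤ) ∣ D.maninConstant) :
    Summit.BirchSwinnertonDyer.BirchSwinnertonDyer.Theses.ManinLocalTwoThree.ManinPrimeToAdditiveFiveLe :=
  maninPrimeToAdditiveFiveLe_of_print_of_kp57_of_reducibleCores (kato_neron_of_five_le hK57) hK57 hCNS
    h500k hKP57 hEdK hEdG h57 h11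

end Summit.BirchSwinnertonDyer.BirchSwinnertonDyer.Theorems

end
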